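import Mathlib
import Summits.Ventures.PercRepro.TriangleCapThreeTrianglesG

/-!
# PercRepro — THREE BELOW THE DIAGONAL, FOUR TRIANGLES, PART A: THE COUNTS (p3, gen 38; part 107)

Towards the band `9 ≤ k ≤ 11` of the sub-diagonal `r = 3`, where the envelope pays for four triangles only from
`k = 12` (`3 (k − 4) ≤ 4 (k − 6)`).  For a `K₄⁻`-free graph whose triangles are exactly four given ones:
* `card_triangles3_le_twentyfour_of_four` — `|T₃| ≤ 24` (the base-pair injection of
  `card_triangles3_le_eighteen_of_three` on four 3-cliques);
* `card_codeg_zero_add_card_triangles3` — the ordered adjacent pairs in no triangle number `2m − |T₃|`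
  (`Σ codeg = |T₃|` with `codeg ≤ 1`);
* `card_codeg_zero_le_sum_deficit_add` — `Σ₀ = Σ_{codeg 0} deficit ≥ #{codeg 0} − #{codeg 0, deficit 0}`;
* `mem_of_deficit_zero` — a pair `(x, y)` in no triangle with deficit `0` (`N(x) ∪ N(y) = V`) meets every
  triangle `T`: `x ∈ T ∨ y ∈ T` (two vertices off `T` cover at most two of its vertices).
With `sum_deficit_split` and `card_mul_add_two_mul_sum_outer_le`: `Σ deficit ≥ 8 (k − 3) + Σ₀`, so the `r = 3`
target `Σ deficit ≥ 6k` needs `Σ₀ ≥ 24 − 2k`, i.e. `#{codeg 0, deficit 0} ≤ 2m − 48 + 2k` — part B bounds the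
«transversal» pairs by `2 max(1, k − 9)`.  Axioms: standard.
-/

namespace PercRepro

namespace TriangleCap

namespace C047

open Finset

variable {V : Type*} [Fintype V] [DecidableEq V]

/-- **AT MOST TWENTY-FOUR ORDERED TRIANGLES** when every triangle's base pair lies inside one of the four 3-cliques
`T₁, …, T₄` and an edge lies in at most one triangle. -/
theorem card_triangles3_le_twentyfour_of_four (D : SimpleGraph V) [DecidableRel D.Adj] (T₁ T₂ T₃ T₄ : Finset V)
    (h₁ : T₁.card = 3) (h₂ : T₂.card = 3) (h₃ : T₃.card = 3) (h₄ : T₄.card = 3)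
    (hcl₁ : ∀ x ∈ T₁, ∀ y ∈ T₁, x ≠ y → D.Adj x y) (hcl₂ : ∀ x ∈ T₂, ∀ y ∈ T₂, x ≠ y → D.Adj x y)
    (hcl₃ : ∀ x ∈ T₃, ∀ y ∈ T₃, x ≠ y → D.Adj x y) (hcl₄ : ∀ x ∈ T₄, ∀ y ∈ T₄, x ≠ y → D.Adj x y)
    (hT : ∀ x y z, D.Adj x y → D.Adj x z → D.Adj y z →
      (x ∈ T₁ ∧ y ∈ T₁) ∨ (x ∈ T₂ ∧ y ∈ T₂) ∨ (x ∈ T₃ ∧ y ∈ T₃) ∨ (x ∈ T₄ ∧ y ∈ T₄))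
    (hcodeg : ∀ x y z z', D.Adj x y → D.Adj x z → D.Adj y z → D.Adj x z' → D.Adj y z' → z = z') :
    (triangles3 D).card ≤ 24 := by
  have hP : ∀ (T : Finset V), T.card = 3 → (∀ x ∈ T, ∀ y ∈ T, x ≠ y → D.Adj x y) →
      ((T ×ˢ T).filter (fun p : V × V => D.Adj p.1 p.2)).card = 6 := by
    intro T hT hcl
    have := adjPairs_eq_sum_degIn D T
    unfold adjPairs at this
    rw [this, sum_congr rfl (fun x hx => degIn_self_of_clique D hT hcl hx), sum_const, hT, smul_eq_mul]
  set U : Finset (V × V) := (T₁ ×ˢ T₁).filter (fun p : V × V => D.Adj p.1 p.2) ∪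
    (T₂ ×ˢ T₂).filter (fun p : V × V => D.Adj p.1 p.2) ∪
    (T₃ ×ˢ T₃).filter (fun p : V × V => D.Adj p.1 p.2) ∪
    (T₄ ×ˢ T₄).filter (fun p : V × V => D.Adj p.1 p.2) with hU
  clear_value U
  have hmaps : Set.MapsTo (fun t : (V × V) × V => t.1) (triangles3 D : Set ((V × V) × V))
      (U : Set (V × V)) := by
    intro s hs
    rw [mem_coe, triangles3, mem_filter, mem_product, mem_adjPairsAll] at hs
    obtain ⟨⟨hxy, -⟩, hxz, hyz⟩ := hs
    rw [mem_coe, hU, mem_union, mem_union, mem_union, mem_filter, mem_filter, mem_filter, mem_filter,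
      mem_product, mem_product, mem_product, mem_product]
    rcases hT s.1.1 s.1.2 s.2 hxy hxz hyz with ⟨h1, h2⟩ | ⟨h1, h2⟩ | ⟨h1, h2⟩ | ⟨h1, h2⟩
    · exact Or.inl (Or.inl (Or.inl ⟨⟨h1, h2⟩, hxy⟩))
    · exact Or.inl (Or.inl (Or.inr ⟨⟨h1, h2⟩, hxy⟩))
    · exact Or.inl (Or.inr ⟨⟨h1, h2⟩, hxy⟩)
    · exact Or.inr ⟨⟨h1, h2⟩, hxy⟩
  have hinj : Set.InjOn (fun t : (V × V) × V => t.1) (triangles3 D) := by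
    intro s hs s' hs' h
    simp only at h
    rw [mem_coe, triangles3, mem_filter, mem_product, mem_adjPairsAll] at hs hs'
    obtain ⟨⟨hxy, -⟩, hxz, hyz⟩ := hs
    obtain ⟨⟨-, -⟩, hxz', hyz'⟩ := hs'
    rw [← h] at hxz' hyz'
    have := hcodeg s.1.1 s.1.2 s.2 s'.2 hxy hxz hyz hxz' hyz'
    exact Prod.ext h this
  have := card_le_card_of_injOn _ hmaps hinj
  have hu1 := card_union_le ((T₁ ×ˢ T₁).filter (fun p : V × V => D.Adj p.1 p.2) ∪
    (T₂ ×ˢ T₂).filter (fun p : V × V => D.Adj p.1 p.2) ∪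
    (T₃ ×ˢ T₃).filter (fun p : V × V => D.Adj p.1 p.2)) ((T₄ ×ˢ T₄).filter (fun p : V × V => D.Adj p.1 p.2))
  have hu2 := card_union_le ((T₁ ×ˢ T₁).filter (fun p : V × V => D.Adj p.1 p.2) ∪
    (T₂ ×ˢ T₂).filter (fun p : V × V => D.Adj p.1 p.2)) ((T₃ ×ˢ T₃).filter (fun p : V × V => D.Adj p.1 p.2))
  have hu3 := card_union_le ((T₁ ×ˢ T₁).filter (fun p : V × V => D.Adj p.1 p.2))
    ((T₂ ×ˢ T₂).filter (fun p : V × V => D.Adj p.1 p.2))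
  rw [← hU] at hu1
  have e1 := hP T₁ h₁ hcl₁
  have e2 := hP T₂ h₂ hcl₂
  have e3 := hP T₃ h₃ hcl₃
  have e4 := hP T₄ h₄ hcl₄
  omega

/-- The ordered adjacent pairs with `codeg = 0` number `2m − |T₃|`. -/
theorem card_codeg_zero_add_card_triangles3 (D : SimpleGraph V) [DecidableRel D.Adj] (hK : K4mFree D) :
    ((adjPairsAll D).filter (fun p => codeg D p = 0)).card + (triangles3 D).card = 2 * D.edgeFinset.card := by
  have h1 := sum_codeg_adjPairsAll D
  have h2 : ∑ p ∈ adjPairsAll D, codeg D p = ((adjPairsAll D).filter (fun p => ¬ codeg D p = 0)).card := by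
    rw [card_eq_sum_ones, sum_filter]
    apply sum_congr rfl
    intro p hp
    have := codeg_le_one D hK hp
    by_cases h : codeg D p = 0
    · simp only [h, not_true_eq_false, if_false]
    · simp only [h, not_false_eq_true, if_true]
      omega
  have h3 := card_filter_add_card_filter_not (fun p => codeg D p = 0) (s := adjPairsAll D)
  rw [card_adjPairsAll] at h3
  omega

omit [DecidableEq V] in
/-- `#{codeg 0} ≤ Σ_{codeg 0} deficit + #{codeg 0, deficit 0}`. -/
theorem card_codeg_zero_le_sum_deficit_add (D : SimpleGraph V) [DecidableRel D.Adj] :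
    ((adjPairsAll D).filter (fun p => codeg D p = 0)).card ≤
      ∑ p ∈ adjPairsAll D, (if codeg D p = 0 then deficit D p else 0) +
      ((adjPairsAll D).filter (fun p => codeg D p = 0 ∧ deficit D p = 0)).card := by
  have hsplit := card_filter_add_card_filter_not (fun p => deficit D p = 0)
    (s := (adjPairsAll D).filter (fun p => codeg D p = 0))
  rw [filter_filter, filter_filter] at hsplit
  have hle : ((adjPairsAll D).filter (fun p => codeg D p = 0 ∧ ¬ deficit D p = 0)).card ≤
      ∑ p ∈ adjPairsAll D, (if codeg D p = 0 then deficit D p else 0) := by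
    rw [card_eq_sum_ones, sum_filter]
    apply sum_le_sum
    intro p _
    by_cases h0 : codeg D p = 0
    · by_cases hd : deficit D p = 0
      · simp only [h0, hd, not_true_eq_false, and_false, if_false, if_true]
        exact Nat.zero_le _
      · simp only [h0, hd, not_false_eq_true, and_self, if_true]
        omega
    · simp only [h0, false_and, if_false]
      exact le_refl _
  omega

/-- A pair `(x, y)` with `N(x) ∪ N(y) = V` (deficit `0`) meets every 3-clique `T` whose outside vertices have at most
one neighbour in it: `x ∈ T ∨ y ∈ T`. -/
theorem mem_of_deficit_zero (D : SimpleGraph V) [DecidableRel D.Adj] {T : Finset V} (hT3 : T.card = 3)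
    (hone : ∀ z, z ∉ T → degIn D T z ≤ 1) {x y : V} (hdef : deficit D (x, y) = 0) : x ∈ T ∨ y ∈ T := by
  by_contra h
  push Not at h
  have hfar : (T.filter (fun t => ¬ D.Adj x t ∧ ¬ D.Adj y t)).card = 0 := by
    rw [card_eq_zero, filter_eq_empty_iff]
    intro t _ ht
    unfold deficit at hdef
    rw [card_eq_zero, filter_eq_empty_iff] at hdef
    exact hdef (mem_univ t) ht
  have := card_le_card_far_add D T x y
  have hx := hone x h.1
  have hy := hone y h.2
  omega

end C047

end TriangleCap

end PercRepro
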